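import Literature.ComputerArithmetic.FloatingPoint.MiniFloat

/-!
# Double rounding of products at equal quanta: the midpoint window as an integer table

HONEST FRAMING (venture CertifiedArithmetic / cell `pub-lowprec`): certified error envelopes and
provably optimal rounding/accumulation schemes for low-precision formats under stated cost models;
every table by two implementations; no hardware or vendor claims.

The integer side (implementation B) of the decision of `DRMul` at equal quanta
(`DoubleRoundingProductSameQuantumLaw.lean`).  Setting: target `φ` (`m = m_φ`, `P = m + 1`) and
register `ψ` with the SAME quantum `q` (`L_ψ = L_φ`, `d = 0`) holding every multiple of `q` in
the range of the products (`m_ψ ≥ 2m + 1`).  A product of `φ`-data is `K·2^E·q`, `K = oa·ob` the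
product of the odd parts; it is exact in `ψ` unless `E = -u < 0`.  In the binade where `φ` has
spacing `2^w q` (`w ≥ 1`) write `K = c·2^(n+1) + r`, `n = w + u - 1`, `2^m ≤ c < 2^(m+1)`: the
nearest multiple of `q` crosses the midpoint `(2c+1)·2^n` of the cell of `φ` — the only way to a
slip — iff `|r - 2^n| ≤ 2^(u-1)` with `c` of the odd-side parity, EXCEPT at the `ψ`-tie
`|r - 2^n| = 2^(u-1)` with `w = 1`, where the midpoint `(2c+1)·q` is an odd multiple and
ties-to-even avoids it (`DoubleRoundingProductSameQuantumWindow.lean`).  Hence the window test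
`mulSameQHitAt P w u oa ob` and `hit₀(P) = mulSameQHit P` (§1; `1 ≤ w, u ≤ P - 1` are forced by
`K < 2^(2P)`): NO hit for `P ≤ 3`, and N-mul-0's witness `(w, u, oa, ob) = (1, m-1, 2^(m-1)+1,
2^(m+1)-1)` is a hit for every `P ≥ 4` — `hit₀(P) ⟺ P ≥ 4` for all `P` (`mulSameQHit_eq_true_iff`;
the table `P ≤ 8` by the kernel, `mulSameQHit_table`).
Two implementations: A = `code/enum/mul_sameq_decision.py` (the table `P ≤ 12` by literal
transcription incl. truncated subtraction, `0, 0, 0, 15, 71, 405, 1738, 7653, 31167, …` hits; hit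
set = brute-force slip set of the exact-rational odd-parts model for `P ≤ 9`) →
`certs/enum/DOUBLE-ROUNDING-MUL-SAMEQ-LAW.json`; B = this file (kernel `decide`).
PLACEMENT — KNOWN: slips happen only through midpoints of the target
([MartinDorelMelquiondMuller2013] Property 2.1; [BoldoMelquiond2008] Thm 3; [Figueroa1995] §2).
NEW (modestly): the window at `d = 0` with its refined tie boundary, as a decidable table.
No hardware or vendor claims.
-/

namespace Summit.Ventures.CertifiedArithmetic

/-! ## §1 The midpoint window at equal quanta, in integers -/

/-- THE WINDOW TEST AT EQUAL QUANTA at one odd pair `(oa, ob)`, binade shift `w ≥ 1` of `φ`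
(spacing `2^w q`) and bit `u ≥ 1` (product `K·q/2^u`): with `n = w + u - 1`,
`K = oa·ob = c·2^(n+1) + r`, `c` a normal significand of precision `P`:
`(c even ∧ 2^n < r ∧ (r < 2^n + 2^(u-1) ∨ (w ≥ 2 ∧ r = 2^n + 2^(u-1)))) ∨
 (c odd ∧ r < 2^n ∧ (2^n - 2^(u-1) < r ∨ (w ≥ 2 ∧ r = 2^n - 2^(u-1))))`. [this packet] -/
def mulSameQHitAt (P w u oa ob : ℕ) : Bool :=
  let n := w + u - 1
  let K := oa * ob
  let c := K / 2 ^ (n + 1)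
  let r := K % 2 ^ (n + 1)
  decide (2 ^ (P - 1) ≤ c) && decide (c < 2 ^ P) &&
    ((c % 2 == 0 && decide (2 ^ n < r) &&
        (decide (r < 2 ^ n + 2 ^ (u - 1)) || (decide (2 ≤ w) && r == 2 ^ n + 2 ^ (u - 1)))) ||
      (c % 2 == 1 && decide (r < 2 ^ n) &&
        (decide (2 ^ n < r + 2 ^ (u - 1)) || (decide (2 ≤ w) && r + 2 ^ (u - 1) == 2 ^ n))))

/-- `hit₀(P)`: some `1 ≤ w, u ≤ P - 1` and odd `oa, ob < 2^P` are in the window. [this packet] -/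
def mulSameQHit (P : ℕ) : Bool :=
  (List.range (P - 1)).any fun v =>
    (List.range (P - 1)).any fun i =>
      (List.range (2 ^ (P - 1))).any fun j =>
        (List.range (2 ^ (P - 1))).any fun k =>
          mulSameQHitAt P (v + 1) (i + 1) (2 * j + 1) (2 * k + 1)

set_option maxHeartbeats 4000000 in
/-- Implementation B of the table for `P ≤ 8` (kernel): NO hit for `P ≤ 3`, a hit for
`4 ≤ P ≤ 8` (implementation A: `0, 0, 0, 15, 71, 405, 1738, 7653` hits for `P = 1, …, 8`, equal
to the number of slipping triples `(oa, ob, u)` of the odd-parts model). [this packet] -/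
theorem mulSameQHit_table :
    (List.range 9).map mulSameQHit = [false, false, false, false, true, true, true, true, true] := by
  decide +kernel

/-- The window disjunction at `K = c·2^(n+1) + r`, `n = w + u - 1`, `2^(P-1) ≤ c < 2^P`, is a hit
of `mulSameQHitAt P w u oa ob`. [this packet] -/
theorem mulSameQHitAt_of_window {P w u oa ob n c r : ℕ} (hn : w + u - 1 = n)
    (hK : oa * ob = c * 2 ^ (n + 1) + r) (hr : r < 2 ^ (n + 1)) (hclo : 2 ^ (P - 1) ≤ c)
    (hchi : c < 2 ^ P)
    (hw : (c % 2 = 0 ∧ 2 ^ n < r ∧ (r < 2 ^ n + 2 ^ (u - 1) ∨ (2 ≤ w ∧ r = 2 ^ n + 2 ^ (u - 1)))) ∨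
      (c % 2 = 1 ∧ r < 2 ^ n ∧ (2 ^ n < r + 2 ^ (u - 1) ∨ (2 ≤ w ∧ r + 2 ^ (u - 1) = 2 ^ n)))) :
    mulSameQHitAt P w u oa ob = true := by
  obtain ⟨hc, hr'⟩ := (Nat.div_mod_unique (a := oa * ob) (b := 2 ^ (n + 1)) (c := r) (d := c)
    (by positivity)).mpr ⟨by rw [hK]; ring, hr⟩
  simp only [mulSameQHitAt]
  rw [hn, hc, hr']
  simp only [Bool.or_eq_true, Bool.and_eq_true, beq_iff_eq, decide_eq_true_eq]; omega

/-- A hit at some `1 ≤ w, u ≤ P - 1` and odd `oa, ob < 2^P` is a hit of `mulSameQHit P`. -/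
theorem mulSameQHit_of_hitAt {P w u oa ob : ℕ} (hw : 1 ≤ w) (hwP : w ≤ P - 1) (hu : 1 ≤ u)
    (huP : u ≤ P - 1) (hoa : oa % 2 = 1) (hoa' : oa < 2 ^ P) (hob : ob % 2 = 1)
    (hob' : ob < 2 ^ P) (h : mulSameQHitAt P w u oa ob = true) : mulSameQHit P = true := by
  have hP : 2 ^ P = 2 * 2 ^ (P - 1) := by
    rcases P with _ | P
    · simp at hoa'; omega
    · rw [pow_succ']; rfl
  unfold mulSameQHit
  simp only [List.any_eq_true, List.mem_range]
  refine ⟨w - 1, by omega, u - 1, by omega, oa / 2, by omega, ob / 2, by omega, ?_⟩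
  rwa [Nat.sub_add_cancel hw, Nat.sub_add_cancel hu, show 2 * (oa / 2) + 1 = oa by omega,
    show 2 * (ob / 2) + 1 = ob by omega]

/-- THE UNIFORM HIT FOR `P ≥ 4` — N-mul-0's witness in the table: `m ≥ 3`, `w = 1`, `u = m - 1`,
`oa = 2^(m-1) + 1`, `ob = 2^(m+1) - 1`: `K = (2^m + 1)·2^m + (2^(m-1) - 1)`, `c = 2^m + 1` odd,
`r = 2^(m-1) - 1 < 2^n = 2^(m-1) < r + 2^(u-1)` (`⟺ m ≥ 3`). [this packet] -/
theorem mulSameQHitAt_family {m : ℕ} (h3 : 3 ≤ m) :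
    mulSameQHitAt (m + 1) 1 (m - 1) (2 ^ (m - 1) + 1) (2 ^ (m + 1) - 1) = true := by
  obtain ⟨a, rfl⟩ : ∃ a, m = a + 3 := ⟨m - 3, by omega⟩
  rw [show a + 3 - 1 = a + 2 by omega, show a + 3 + 1 = a + 4 by omega]
  have hX : 1 ≤ 2 ^ a := Nat.one_le_two_pow
  have p1 : 2 ^ (a + 1) = 2 * 2 ^ a := by ring
  have p2 : 2 ^ (a + 2) = 4 * 2 ^ a := by ring
  have p3 : 2 ^ (a + 3) = 8 * 2 ^ a := by ring
  have p4 : 2 ^ (a + 4) = 16 * 2 ^ a := by ring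
  refine mulSameQHitAt_of_window (n := a + 2) (c := 2 ^ (a + 3) + 1) (r := 2 ^ (a + 2) - 1)
    (by omega) ?_ ?_ ?_ ?_ ?_
  · rw [show a + 2 + 1 = a + 3 by omega, p2, p3, p4]
    obtain ⟨Y, hY⟩ : ∃ Y, 2 ^ a = Y + 1 := ⟨2 ^ a - 1, by omega⟩
    rw [hY, show 16 * (Y + 1) - 1 = 16 * Y + 15 by omega, show 4 * (Y + 1) - 1 = 4 * Y + 3 by omega]
    ring
  · rw [show a + 2 + 1 = a + 3 by omega, p2, p3]; omega
  · rw [show a + 4 - 1 = a + 3 by omega]; omega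
  · rw [p3, p4]; omega
  · right
    refine ⟨?_, ?_, Or.inl ?_⟩
    · rw [p3]; omega
    · rw [p2]; omega
    · rw [show a + 2 - 1 = a + 1 by omega, p1, p2]; omega

/-- THE TABLE IN CLOSED FORM, all `P`: `hit₀(P) ⟺ P ≥ 4` (`P ≤ 3` by the kernel, `P ≥ 4` by the
uniform hit). [this packet] -/
theorem mulSameQHit_eq_true_iff {P : ℕ} : mulSameQHit P = true ↔ 4 ≤ P := by
  have h4 : ∀ Q < 4, mulSameQHit Q = false := by decide +kernel
  rcases Nat.lt_or_ge P 4 with hP | hP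
  · rw [h4 P hP]; simp only [Bool.false_eq_true, false_iff, not_le]; exact hP
  · refine ⟨fun _ => hP, fun _ => ?_⟩
    obtain ⟨m, rfl⟩ : ∃ m, P = m + 1 := ⟨P - 1, by omega⟩
    have hpow : 2 ^ (m + 1) = 2 * 2 ^ m := pow_succ' 2 m
    have hpm : 2 ^ m = 2 * 2 ^ (m - 1) := by rw [← pow_succ']; congr 1; omega
    have hev : 2 ^ (m - 1) % 2 = 0 := by
      rw [show m - 1 = (m - 2) + 1 by omega, pow_succ]; exact Nat.mul_mod_left _ _
    have h1 : 1 ≤ 2 ^ (m - 1) := Nat.one_le_two_pow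
    exact mulSameQHit_of_hitAt (P := m + 1) (w := 1) (u := m - 1) (oa := 2 ^ (m - 1) + 1)
      (ob := 2 ^ (m + 1) - 1) le_rfl (by omega) (by omega) (by omega) (by omega) (by omega)
      (by omega) (by omega) (mulSameQHitAt_family (by omega))

end Summit.Ventures.CertifiedArithmetic
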